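import Literature.MathematicalPhysics.QuantumFieldTheory.Balaban1983to89.B6Repr2129Positivity
import Literature.MathematicalPhysics.QuantumFieldTheory.Balaban1983to89.B6SectCTwoScaleV1Lattice

/-!
# `Balaban1983to89.B6Eq2146TwoScale` — T. Bałaban, *Propagators and renormalization transformations for lattice gauge
# theories. II*, Commun. Math. Phys. **96** (1984) 223–250 [Balaban1984PropagatorsII], (2.144)–(2.146) p. 248: **`⟨B, QGQ*B⟩ =
# ⟨Q″*B, C̃^{(j)}_ΛQ″*B⟩`** for the operators DEFINED in `…B6SectCOperators`, from the two positivity facts only — *"we may drop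
# terms which appeared because of the non-invariance of ⟨A,J⟩"* PROVED (the dropped terms VANISH at `J = Q*B`), *"The first term …
# is equal to 0 by the definition of G̃_j"*, *"Q_jH_j = I"* — and for the concrete two-scale lattice operators of the V1 calculus

statement-level skeleton of published theorems with citation tags; proofs where landed; nothing here is a claim about the Yang–Mills mass gap

PDF held: `paper:balaban1984-cmp96-propagators-rt-ii` (journal page = PDF page + 222); p. 248 read AS IMAGE on the ×2 render
`run/shared/lean/pub/pub-balaban/b2b-balaban-ref1/pages/1984-cmp96-propagators-rt-II/…-p026-x2.png` (2026-08-21).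
CITATION HEADER (lean-in-tree rule).  WHAT IS REPRODUCED: lit-balaban SKELETON row **B6.Eq2.144** ((2.144)–(2.146) p. 248), the
IDENTITY part, as a consequence of this seat's (2.129) for the constructed operators (`…B6Repr2129Positivity.eq2129_of_pos`): gen 3's
`…B6Eq2144.eq2145`/`eq2146` typed the same passage over abstract carriers with the vanishing of the dropped terms, `Q_jG̃_j = 0` and
`Q_jH_j = I` as HYPOTHESES; here they are THEOREMS for the operators of `…B6SectCOperators.TwoScaleData` under `IsLattice` + `Positive`,
and hypothesis-free for the concrete data `…B6SectCTwoScaleV1Lattice.tsV1` (`eq2146_V1`).  PHASE-2 seat p22 (gen 8); owner r03, referee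
ref-4.  IMPORTS BY NAME, restating nothing: `eq2129_of_pos`, `…B6SectCPositivity.{Qp_hP_apply, Qv_Hj, Hjs_adj, deltaA_pos}`,
`…B6CovarianceOperator.{covOp_apply, covOp_mem, inverse_pos}`, `…B6SectCTwoScaleV1Lattice.{isLattice, positive}`.

PRINT (p. 248, verbatim).  *"⟨B,(QG_□Q*)↾_□B⟩ = … = (L^jη)^{d+2}⟨Q″*B, Q_jG^ξ_□Q_j*Q″*B⟩, (2.144) where Q″ is defined, as in (2.119) …
The expression on the right-hand side in (2.144) is equal to ⟨Q*B, GQ*B⟩ and is defined by the integral in (2.95) with ⟨A,J⟩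
replaced by ⟨A,Q*B⟩ = ⟨QA,B⟩. This expression is gauge-invariant with respect to gauge transformations given by λ satisfying Q′λ = 0.
In the calculations between (2.95) and (2.129) we made such transformations only, and we may drop terms which appeared because of
the non-invariance of ⟨A,J⟩. We obtain ⟨B,QGQ*B⟩ = ⟨B,QG̃_jQ*B⟩ + ⟨B,QH_jC̃^{(j)}_ΛH_j*Q*B⟩ = ⟨Q″*B,Q_jG̃_jQ_j*Q″*B⟩ +
⟨Q″*B,Q_jH_jC̃^{(j)}_ΛH_j*Q_j*Q″*B⟩. (2.145) The first term on the right-hand side of the last equality is equal to 0 by the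
definition of G̃_j. From the definition of H_j we have Q_jH_j = I, hence ⟨B,QGQ*B⟩ = ⟨Q″*B, C̃^{(j)}_ΛQ″*B⟩ (2.146)"*.

CONTENTS (0 sorry; standard axioms; `D : TwoScaleData …`, `hL : D.IsLattice`, `hP : D.Positive`).  §1 the dropped terms VANISH at
`J = Q*B`: `covOp_eq_zero_of_orth` (a covariance `ι(ι*Sι)⁻¹ι*` kills vectors orthogonal to its subspace), `source_orth` (`H′_j*∂*Q*B ⊥`
admissible `ω`: `⟨ω, H′_j*∂*Q*B⟩ = ⟨Q∂H′_jω, B⟩ = ⟨Q″∂₁ω, B⟩ = 0` by (2.103), `Q′_jH′_j = I`, (2.104)), `C_source_eq_zero`, **`K1_Qs`,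
`K2_Qs`** (`∂H′_jC^{(j)}_ΛH′_j*∂*Q*B = 0 = ∂ΔH′_jC^{(j)}_ΛH′_j*∂*Q*B`).  §2 `inner_Qs_Gt` (*"equal to 0 by the definition of G̃_j"*:
`G̃_j` ranges in `{Q_jA = 0}`), `Hjs_Qs` (`H_j*Q*B = Q″*B` from `Q_jH_j = I`), **`eq2145`**, **`eq2146`** (`⟨Q*B, GQ*B⟩ = ⟨Q″*B,
C̃^{(j)}_ΛQ″*B⟩`), `eq2146_printed` (`⟨B, QGQ*B⟩ = …`), `QGQs_pos` (*"The operator QGQ* is positive"*: `> 0` whenever `Q*B ≠ 0`).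
§3 `eq2146_V1`: the same for the concrete data `tsV1 hc Λ′ w` (hypotheses `c ≠ 0`, `j + 1 ≤ m + K`, `w > 0` only).  HONEST SCOPE:
identity part of (2.144)–(2.146) only; the scaling `(L^jη)^{d+2}` of (2.144) (unit conventions) and the BOUND (2.147) (needs the
lower bound of `‖B₁‖²` and the upper bound of the form (2.120): gen 3's `…B6Eq2144.ineq2147_printed` under displayed hypotheses) are
not treated here; `B₁` of (2.146) second equality is gen 3's `eq2146_B1`; NOT summit progress.
Unit `lit-balaban-p22` (gen 8), HOME `run/shared/lean/pub/lit-balaban/`, 2026-08-21.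
-/

noncomputable section

open scoped InnerProductSpace

namespace Literature.MathematicalPhysics.QuantumFieldTheory.Balaban1983to89.B6Eq2146TwoScale

open B6CovarianceOperator B6SectCOperators B6SectCOperators.TwoScaleData B6SectCPositivity

/-! ## §1  The dropped terms vanish at `J = Q*B` -/

section Cov

variable {X : Type*} [NormedAddCommGroup X] [InnerProductSpace ℝ X] [FiniteDimensional ℝ X]

/-- A covariance `C = ι(ι*Sι)⁻¹ι*` carried by a subspace `K` kills every vector orthogonal to `K` (the mechanism of *"we may drop
terms"*, cf. gen 3's `…B6Eq2144.cov_apply_eq_zero`). [cite: Balaban1984PropagatorsII, (2.145) p.248] -/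
theorem covOp_eq_zero_of_orth (K : Submodule ℝ X) (S : X →ₗ[ℝ] X) (v : X) (hv : ∀ k : ↥K, ⟪(k : X), v⟫_ℝ = 0) :
    covOp K S v = 0 := by
  have h0 : LinearMap.adjoint K.subtype v = 0 := by
    apply ext_inner_left ℝ
    intro k
    rw [LinearMap.adjoint_inner_right, inner_zero_right]
    exact hv k
  rw [covOp_apply, show covOpT K S v = Ring.inverse (compress K S) (LinearMap.adjoint K.subtype v) from rfl, h0, map_zero,
    map_zero]

end Cov

variable {A B W T Bs V : Type*}
  [NormedAddCommGroup A] [InnerProductSpace ℝ A] [FiniteDimensional ℝ A]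
  [NormedAddCommGroup B] [InnerProductSpace ℝ B] [FiniteDimensional ℝ B]
  [NormedAddCommGroup W] [InnerProductSpace ℝ W] [FiniteDimensional ℝ W]
  [NormedAddCommGroup T] [InnerProductSpace ℝ T] [FiniteDimensional ℝ T]
  [NormedAddCommGroup Bs] [InnerProductSpace ℝ Bs] [FiniteDimensional ℝ Bs]
  [NormedAddCommGroup V] [InnerProductSpace ℝ V] [FiniteDimensional ℝ V]
  {D : TwoScaleData A B W T Bs V}

/-- **the source `H′_j*∂*Q*B` is orthogonal to the admissible `ω`**: `⟨ω, H′_j*∂*Q*B⟩ = ⟨Q∂H′_jω, B⟩ = ⟨Q″∂₁Q′_jH′_jω, B⟩ = ⟨Q″∂₁ω,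
B⟩ = 0` by (2.103), `Q′_jH′_j = I`, (2.104) — *"⟨A,Q*B⟩ = ⟨QA,B⟩ … is gauge-invariant"*. [cite: Balaban1984PropagatorsII, (2.144)–(2.145) p.248] -/
theorem source_orth (hL : D.IsLattice) (ω : ↥D.S₁) (x : V) :
    ⟪(ω : W), LinearMap.adjoint D.hP (D.dv (LinearMap.adjoint D.Q x))⟫_ℝ = 0 := by
  rw [LinearMap.adjoint_inner_right, ← hL.grad_adj, LinearMap.adjoint_inner_right,
    show D.Q (D.grad (D.hP (ω : W))) = D.Qpp (D.Qv (D.grad (D.hP (ω : W)))) from rfl, hL.Qv_grad, Qp_hP_apply hL,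
    hL.Qpp_d1 ω, inner_zero_left]

/-- hence `C^{(j)}_ΛH′_j*∂*Q*B = 0`. [cite: Balaban1984PropagatorsII, (2.145) p.248] -/
theorem C_source_eq_zero (hL : D.IsLattice) (x : V) : D.C (LinearMap.adjoint D.hP (D.dv (LinearMap.adjoint D.Q x))) = 0 :=
  covOp_eq_zero_of_orth D.S₁ D.Dp _ fun ω => source_orth hL ω x

/-- **the first dropped term vanishes: `∂H′_jC^{(j)}_ΛH′_j*∂*(Q*B) = 0`.** [cite: Balaban1984PropagatorsII, (2.145) p.248] -/
theorem K1_Qs (hL : D.IsLattice) (x : V) : D.K1 (LinearMap.adjoint D.Q x) = 0 := by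
  show D.grad (D.hP (D.C (LinearMap.adjoint D.hP (D.dv (LinearMap.adjoint D.Q x))))) = 0
  rw [C_source_eq_zero hL, map_zero, map_zero]

/-- **the second dropped term vanishes: `∂ΔH′_jC^{(j)}_ΛH′_j*∂*(Q*B) = 0`.** [cite: Balaban1984PropagatorsII, (2.145) p.248] -/
theorem K2_Qs (hL : D.IsLattice) (x : V) : D.K2 (LinearMap.adjoint D.Q x) = 0 := by
  show D.grad (D.lap (D.hP (D.C (LinearMap.adjoint D.hP (D.dv (LinearMap.adjoint D.Q x)))))) = 0
  rw [C_source_eq_zero hL, map_zero, map_zero, map_zero]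

/-! ## §2  (2.145)–(2.146) -/

/-- *"The first term … is equal to 0 by the definition of G̃_j"*: `G̃_j` ranges in `{Q_jA = 0}`, so `⟨Q*B′, G̃_jK⟩ = ⟨B′, Q″Q_jG̃_jK⟩ = 0`.
[cite: Balaban1984PropagatorsII, (2.145)–(2.146) p.248] -/
theorem inner_Qs_Gt (x : V) (K : A) : ⟪LinearMap.adjoint D.Q x, D.Gt K⟫_ℝ = 0 := by
  have h : D.Qv (D.Gt K) = 0 := covOp_mem D.NA D.Mj K
  rw [Qs_adj, h, map_zero, inner_zero_right]

/-- *"From the definition of H_j we have Q_jH_j = I"*, hence `H_j*Q*B = Q″*B`. [cite: Balaban1984PropagatorsII, (2.146) p.248] -/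
theorem Hjs_Qs (hL : D.IsLattice) (hP : D.Positive) (x : V) :
    LinearMap.adjoint D.Hj (LinearMap.adjoint D.Q x) = LinearMap.adjoint D.Qpp x := by
  apply ext_inner_left ℝ
  intro b
  rw [← Hjs_adj, real_inner_comm, Qs_adj, Qv_Hj hL hP, LinearMap.adjoint_inner_right, real_inner_comm]

/-- **(2.145)**: at `J = Q*B` the representation (2.129) reads `⟨Q*B, GQ*B⟩ = ⟨Q*B, G̃_jQ*B⟩ + ⟨Q*B, H_jC̃^{(j)}_ΛH_j*Q*B⟩` (the
`∂H′_jC^{(j)}_Λ…` terms dropped — they vanish, §1). [cite: Balaban1984PropagatorsII, (2.145) p.248] -/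
theorem eq2145 (hL : D.IsLattice) (hP : D.Positive) (x : V) :
    ⟪LinearMap.adjoint D.Q x, D.G (LinearMap.adjoint D.Q x)⟫_ℝ =
      ⟪LinearMap.adjoint D.Q x, D.Gt (LinearMap.adjoint D.Q x)⟫_ℝ +
        ⟪LinearMap.adjoint D.Q x, D.Hj (D.Ct (LinearMap.adjoint D.Hj (LinearMap.adjoint D.Q x)))⟫_ℝ := by
  have h := B6Repr2129Positivity.eq2129_of_pos hL hP (LinearMap.adjoint D.Q x)
  rw [K1_Qs hL, K2_Qs hL, inner_zero_right, zero_add, sub_zero, LinearMap.add_apply, inner_add_right] at h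
  exact h

/-- **(2.146) `⟨Q*B, GQ*B⟩ = ⟨Q″*B, C̃^{(j)}_ΛQ″*B⟩`** for the operators of `…B6SectCOperators` (G = Δ_a⁻¹, C̃^{(j)}_Λ the covariance of
`Q″*aQ″ + Δ_j` on the axial `B`), from `IsLattice` + the two positivity facts only. [cite: Balaban1984PropagatorsII, (2.146) p.248] -/
theorem eq2146 (hL : D.IsLattice) (hP : D.Positive) (x : V) :
    ⟪LinearMap.adjoint D.Q x, D.G (LinearMap.adjoint D.Q x)⟫_ℝ =
      ⟪LinearMap.adjoint D.Qpp x, D.Ct (LinearMap.adjoint D.Qpp x)⟫_ℝ := by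
  rw [eq2145 hL hP, inner_Qs_Gt, zero_add, real_inner_comm, Hjs_adj, Hjs_Qs hL hP, real_inner_comm]

/-- (2.146) in the printed shape `⟨B, QGQ*B⟩ = ⟨Q″*B, C̃^{(j)}_ΛQ″*B⟩`. [cite: Balaban1984PropagatorsII, (2.146) p.248] -/
theorem eq2146_printed (hL : D.IsLattice) (hP : D.Positive) (x : V) :
    ⟪x, D.Q (D.G (LinearMap.adjoint D.Q x))⟫_ℝ = ⟪LinearMap.adjoint D.Qpp x, D.Ct (LinearMap.adjoint D.Qpp x)⟫_ℝ := by
  rw [← LinearMap.adjoint_inner_left, eq2146 hL hP]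

/-- *"The operator QGQ* is positive"*: `⟨Q*B, GQ*B⟩ > 0` whenever `Q*B ≠ 0` (`G = Δ_a⁻¹ > 0`). [cite: Balaban1984PropagatorsII, (2.143) p.248] -/
theorem QGQs_pos (hL : D.IsLattice) (hP : D.Positive) (x : V) (hx : LinearMap.adjoint D.Q x ≠ 0) :
    0 < ⟪LinearMap.adjoint D.Q x, D.G (LinearMap.adjoint D.Q x)⟫_ℝ :=
  inverse_pos D.deltaA (deltaA_pos hL hP) _ hx

/-! ## §3  For the concrete two-scale lattice operators -/

section V1

open B6SectAOperatorsV1 B6SectCTwoScaleV1 B6SectCTwoScaleV1Lattice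

variable {P : Params} {c : ℝ} (hc : c ≠ 0) {j : ℕ} (hj : j + 1 ≤ P.m + P.K) (Λ' : Finset (Site P (j + 1)))
  {w : CIdx j Λ' → ℝ} (hw : ∀ i, 0 < w i)

include hj hw

/-- **(2.146) FOR THE CONCRETE TWO-SCALE LATTICE OPERATORS** `tsV1 hc Λ′ w` (fine torus `T^{(0)}`, unit lattice `T^{(j)}`, `Λ′ ⊂
T^{(j+1)}`): `⟨Q*B, GQ*B⟩ = ⟨Q″*B, C̃^{(j)}_ΛQ″*B⟩`, hypotheses `c ≠ 0`, `j + 1 ≤ m + K`, `w > 0` only. [cite: Balaban1984PropagatorsII, (2.146) p.248] -/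
theorem eq2146_V1 (x : CSpace j Λ') :
    ⟪LinearMap.adjoint (tsV1 hc Λ' w).Q x, (tsV1 hc Λ' w).G (LinearMap.adjoint (tsV1 hc Λ' w).Q x)⟫_ℝ =
      ⟪LinearMap.adjoint (tsV1 hc Λ' w).Qpp x, (tsV1 hc Λ' w).Ct (LinearMap.adjoint (tsV1 hc Λ' w).Qpp x)⟫_ℝ :=
  eq2146 (isLattice Λ' hc hj hw) (positive Λ' hc hj w) x

/-- and in the printed shape `⟨B, QGQ*B⟩ = ⟨Q″*B, C̃^{(j)}_ΛQ″*B⟩` for the concrete operators. [cite: Balaban1984PropagatorsII, (2.146) p.248] -/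
theorem eq2146_printed_V1 (x : CSpace j Λ') :
    ⟪x, (tsV1 hc Λ' w).Q ((tsV1 hc Λ' w).G (LinearMap.adjoint (tsV1 hc Λ' w).Q x))⟫_ℝ =
      ⟪LinearMap.adjoint (tsV1 hc Λ' w).Qpp x, (tsV1 hc Λ' w).Ct (LinearMap.adjoint (tsV1 hc Λ' w).Qpp x)⟫_ℝ :=
  eq2146_printed (isLattice Λ' hc hj hw) (positive Λ' hc hj w) x

end V1

end Literature.MathematicalPhysics.QuantumFieldTheory.Balaban1983to89.B6Eq2146TwoScale

end
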